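import Mathlib
import Summits.Ventures.PercRepro2.A3CutCrossSums

/-!
# The cross-shield identity: `btw(x) = 0` when the explored cut vertex `x` separates `{a₁, o}` from
`{a₂, b}`
(blind cell PercRepro2, night-1 g33; proofs/NIGHT1-G33.md §7; census 294/294 (three mirrors, n = 9),
the atom identities 147/147 — mining/night-1/g33/check_a1o.py, check_cross_atoms.py)

Setting of A3CutCrossFibres.  With the `A`-atoms `A₀, A₁, Aρ₀` and the `B`-atoms
`B₀ = ∑_{T ∌ a₂} μ(T)`, `B₂ = ∑_{T ∋ a₂} μ(T)`, `Bβ₀, Bβ₂ = ∑ μ_b(T)` over the same classes and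
`Bb₀ = ∑_{T ∌ a₂, b ∈ T} μ(T)`, the six fibre sums of `btw` are (`sum_mW_cross`, `sum_Ssig_b_cross`,
`sum_SFg_cross`, `sum_term_cross`, `sum_termA_cross`, `sum_SuA_b_cross`, `sum_SuA_o_cross`,
`prob_PD_cross`):
`P(Q) = B₂ A₀ + B₀ (A₁ + A₀)`, `∑ Sb = −Bβ₂ A₀ + (Bb₀ − Bβ₀) A₁ − Bβ₀ A₀`,
`∑ F = B₂ (2 Aρ₀ − γ A₀) + B₀ (γ A₁ + Aρ₀)`, `∑ Sb F / m = −Bβ₂ (2 Aρ₀ − γ A₀) + γ (Bb₀ − Bβ₀) A₁ − Bβ₀ Aρ₀`,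
`∑_A Sub Suo / m = Bβ₀ Aρ₀`, `∑_A Sub = Bβ₀ A₀`, `∑_A Suo = B₀ Aρ₀`, `D = B₀ A₀`;
so `γ = D_o / D = Aρ₀ / A₀`, the ratio sum is `γ ∑ Sb`, the `F`-sum is `γ P(Q)`, and everything
cancels: **`btw_cross`** (`P(PD_x) ≠ 0`), **`A3Between_cross`** and **`HCov_cross`** (unconditional).
The mirrors (`{a₁, b}` behind `x`, or the sides exchanged) are the same theorem after the root swap
and `IsCut.symm` — not restated here.  Standard axioms.
-/

namespace Summit.Ventures.PercRepro2

open UnionCluster CovForm CutV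

namespace CovForm

namespace A3Fibre

namespace CrossShield

section Assembly

variable {V : Type*} {E : Type*} [Fintype V] [DecidableEq V] [Fintype E] [DecidableEq E]
  {R : Type*} [Field R] [LinearOrder R] [IsStrictOrderedRing R] {ends : E → Sym2 V} {x : V}
  {VA VB : Finset V} {EA EB : Set E} [DecidablePred (· ∈ EA)] [DecidablePred (· ∈ EB)] {p : E → R}
  {a₁ a₂ o b : V}

/-! ## The full sums -/

omit [Fintype V] [Fintype E] [DecidableEq E] [Field R] [LinearOrder R] [IsStrictOrderedRing R]
  [DecidablePred (· ∈ EA)] [DecidablePred (· ∈ EB)] in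
/-- A sum over `T ∈ TT` splits by `a₂ ∈ T`. -/
lemma sum_T_split {M : Type*} [AddCommMonoid M] (g : Finset V → M) :
    ∑ T ∈ (insert x VB).powerset.filter (fun T => x ∈ T), g T =
      ∑ T ∈ ((insert x VB).powerset.filter (fun T => x ∈ T)).filter (fun T => a₂ ∈ T), g T +
        ∑ T ∈ ((insert x VB).powerset.filter (fun T => x ∈ T)).filter (fun T => a₂ ∉ T), g T :=
  (Finset.sum_filter_add_sum_filter_not _ (fun T => a₂ ∈ T) g).symm

omit [Fintype V] [Fintype E] [DecidableEq E] [Field R] [LinearOrder R] [IsStrictOrderedRing R]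
  [DecidablePred (· ∈ EA)] [DecidablePred (· ∈ EB)] in
/-- Membership in the `a₂ ∈ T` class. -/
lemma mem_TT2 {T : Finset V}
    (hT : T ∈ ((insert x VB).powerset.filter (fun T => x ∈ T)).filter (fun T => a₂ ∈ T)) :
    (T ⊆ insert x VB ∧ x ∈ T) ∧ a₂ ∈ T := by
  rw [Finset.mem_filter, Finset.mem_filter, Finset.mem_powerset] at hT
  exact hT

omit [Fintype V] [Fintype E] [DecidableEq E] [Field R] [LinearOrder R] [IsStrictOrderedRing R]
  [DecidablePred (· ∈ EA)] [DecidablePred (· ∈ EB)] in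
/-- Membership in the `a₂ ∉ T` class. -/
lemma mem_TT0 {T : Finset V}
    (hT : T ∈ ((insert x VB).powerset.filter (fun T => x ∈ T)).filter (fun T => a₂ ∉ T)) :
    (T ⊆ insert x VB ∧ x ∈ T) ∧ a₂ ∉ T := by
  rw [Finset.mem_filter, Finset.mem_filter, Finset.mem_powerset] at hT
  exact hT

omit [LinearOrder R] [IsStrictOrderedRing R] in
/-- `P(Q) = ∑_W m_W = B₂ A₀ + B₀ (A₁ + A₀)`. -/
lemma sum_mW_cross (h : IsCut ends x ↑VA ↑VB EA EB) (ha1 : a₁ ∈ VA) (ha2 : a₂ ∈ insert x VB) :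
    ∑ W : Finset V, mW p ends a₁ a₂ x W =
      (∑ T ∈ ((insert x VB).powerset.filter (fun T => x ∈ T)).filter (fun T => a₂ ∈ T),
          muT p ends EB x T) *
        (∑ S ∈ VA.powerset.filter (fun S => a₁ ∉ S), alphaS p ends EA x S) +
      (∑ T ∈ ((insert x VB).powerset.filter (fun T => x ∈ T)).filter (fun T => a₂ ∉ T),
          muT p ends EB x T) *
        (∑ S ∈ VA.powerset.filter (fun S => a₁ ∈ S), alphaS p ends EA x S +
          ∑ S ∈ VA.powerset.filter (fun S => a₁ ∉ S), alphaS p ends EA x S) := by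
  have e2 : ∑ T ∈ ((insert x VB).powerset.filter (fun T => x ∈ T)).filter (fun T => a₂ ∈ T), ∑ S ∈ VA.powerset, mW p ends a₁ a₂ x (S ∪ T) =
      ∑ T ∈ ((insert x VB).powerset.filter (fun T => x ∈ T)).filter (fun T => a₂ ∈ T), muT p ends EB x T * (∑ S ∈ VA.powerset.filter (fun S => a₁ ∉ S), alphaS p ends EA x S) :=
    Finset.sum_congr rfl fun T hT => by
      obtain ⟨⟨hT', hxT⟩, h2⟩ := mem_TT2 hT
      exact sum_S_mW_of_mem h ha1 ha2 hT' hxT h2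
  have e0 : ∑ T ∈ ((insert x VB).powerset.filter (fun T => x ∈ T)).filter (fun T => a₂ ∉ T), ∑ S ∈ VA.powerset, mW p ends a₁ a₂ x (S ∪ T) =
      ∑ T ∈ ((insert x VB).powerset.filter (fun T => x ∈ T)).filter (fun T => a₂ ∉ T), muT p ends EB x T * ((∑ S ∈ VA.powerset.filter (fun S => a₁ ∈ S), alphaS p ends EA x S) + (∑ S ∈ VA.powerset.filter (fun S => a₁ ∉ S), alphaS p ends EA x S)) :=
    Finset.sum_congr rfl fun T hT => by
      obtain ⟨⟨hT', hxT⟩, h2⟩ := mem_TT0 hT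
      exact sum_S_mW_of_notMem h ha1 ha2 hT' hxT h2
  rw [sum_cross_pairs h a₁ a₂ _ (fun W hW => by unfold mW; rw [hW, prob_empty]),
    sum_T_split (a₂ := a₂), e2, e0, ← Finset.sum_mul, ← Finset.sum_mul]

omit [LinearOrder R] [IsStrictOrderedRing R] in
/-- `∑_W Sb_W = −Bβ₂ A₀ + (Bb₀ − Bβ₀) A₁ − Bβ₀ A₀`. -/
lemma sum_Ssig_b_cross (h : IsCut ends x ↑VA ↑VB EA EB) (ha1 : a₁ ∈ VA) (ha2 : a₂ ∈ insert x VB)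
    (hb : b ∈ insert x VB) :
    ∑ W : Finset V, Ssig p ends a₁ a₂ x b W =
      -((∑ T ∈ ((insert x VB).powerset.filter (fun T => x ∈ T)).filter (fun T => a₂ ∈ T),
          muB p ends EB x a₂ b T) *
        (∑ S ∈ VA.powerset.filter (fun S => a₁ ∉ S), alphaS p ends EA x S)) +
      ((∑ T ∈ ((insert x VB).powerset.filter (fun T => x ∈ T)).filter (fun T => a₂ ∉ T),
            (if b ∈ T then muT p ends EB x T else 0)) -
          ∑ T ∈ ((insert x VB).powerset.filter (fun T => x ∈ T)).filter (fun T => a₂ ∉ T),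
            muB p ends EB x a₂ b T) *
        (∑ S ∈ VA.powerset.filter (fun S => a₁ ∈ S), alphaS p ends EA x S) -
      (∑ T ∈ ((insert x VB).powerset.filter (fun T => x ∈ T)).filter (fun T => a₂ ∉ T),
          muB p ends EB x a₂ b T) *
        (∑ S ∈ VA.powerset.filter (fun S => a₁ ∉ S), alphaS p ends EA x S) := by
  have e2 : ∑ T ∈ ((insert x VB).powerset.filter (fun T => x ∈ T)).filter (fun T => a₂ ∈ T), ∑ S ∈ VA.powerset, Ssig p ends a₁ a₂ x b (S ∪ T) =
      ∑ T ∈ ((insert x VB).powerset.filter (fun T => x ∈ T)).filter (fun T => a₂ ∈ T), -(muB p ends EB x a₂ b T * (∑ S ∈ VA.powerset.filter (fun S => a₁ ∉ S), alphaS p ends EA x S)) :=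
    Finset.sum_congr rfl fun T hT => by
      obtain ⟨⟨hT', hxT⟩, h2⟩ := mem_TT2 hT
      exact sum_S_Ssig_b_of_mem h ha1 ha2 hb hT' hxT h2
  have e0 : ∑ T ∈ ((insert x VB).powerset.filter (fun T => x ∈ T)).filter (fun T => a₂ ∉ T), ∑ S ∈ VA.powerset, Ssig p ends a₁ a₂ x b (S ∪ T) =
      ∑ T ∈ ((insert x VB).powerset.filter (fun T => x ∈ T)).filter (fun T => a₂ ∉ T), (((if b ∈ T then muT p ends EB x T else 0) - muB p ends EB x a₂ b T) * (∑ S ∈ VA.powerset.filter (fun S => a₁ ∈ S), alphaS p ends EA x S) -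
        muB p ends EB x a₂ b T * (∑ S ∈ VA.powerset.filter (fun S => a₁ ∉ S), alphaS p ends EA x S)) :=
    Finset.sum_congr rfl fun T hT => by
      obtain ⟨⟨hT', hxT⟩, h2⟩ := mem_TT0 hT
      exact sum_S_Ssig_b_of_notMem h ha1 ha2 hb hT' hxT h2
  rw [sum_cross_pairs h a₁ a₂ _ (fun W hW => by unfold Ssig; rw [hW]; simp),
    sum_T_split (a₂ := a₂), e2, e0, Finset.sum_neg_distrib, ← Finset.sum_mul, Finset.sum_sub_distrib,
    ← Finset.sum_mul, ← Finset.sum_mul, Finset.sum_sub_distrib]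
  ring

omit [LinearOrder R] [IsStrictOrderedRing R] in
/-- `∑_W SFg(γ)_W = B₂ (2 Aρ₀ − γ A₀) + B₀ (γ A₁ + Aρ₀)`. -/
lemma sum_SFg_cross (h : IsCut ends x ↑VA ↑VB EA EB) (ha1 : a₁ ∈ VA) (ho : o ∈ VA)
    (ha2 : a₂ ∈ insert x VB) (γ : R) :
    ∑ W : Finset V, RootEdge.SFg p ends o a₁ a₂ x γ W =
      (∑ T ∈ ((insert x VB).powerset.filter (fun T => x ∈ T)).filter (fun T => a₂ ∈ T),
          muT p ends EB x T) *
        (2 * ∑ S ∈ VA.powerset.filter (fun S => a₁ ∉ S), alphaO p ends EA x a₁ o S -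
          γ * ∑ S ∈ VA.powerset.filter (fun S => a₁ ∉ S), alphaS p ends EA x S) +
      (∑ T ∈ ((insert x VB).powerset.filter (fun T => x ∈ T)).filter (fun T => a₂ ∉ T),
          muT p ends EB x T) *
        (γ * ∑ S ∈ VA.powerset.filter (fun S => a₁ ∈ S), alphaS p ends EA x S +
          ∑ S ∈ VA.powerset.filter (fun S => a₁ ∉ S), alphaO p ends EA x a₁ o S) := by
  have e2 : ∑ T ∈ ((insert x VB).powerset.filter (fun T => x ∈ T)).filter (fun T => a₂ ∈ T), ∑ S ∈ VA.powerset, RootEdge.SFg p ends o a₁ a₂ x γ (S ∪ T) =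
      ∑ T ∈ ((insert x VB).powerset.filter (fun T => x ∈ T)).filter (fun T => a₂ ∈ T), muT p ends EB x T * (2 * (∑ S ∈ VA.powerset.filter (fun S => a₁ ∉ S), alphaO p ends EA x a₁ o S) - γ * (∑ S ∈ VA.powerset.filter (fun S => a₁ ∉ S), alphaS p ends EA x S)) :=
    Finset.sum_congr rfl fun T hT => by
      obtain ⟨⟨hT', hxT⟩, h2⟩ := mem_TT2 hT
      exact sum_S_SFg_of_mem h ha1 ho ha2 hT' hxT h2 γ
  have e0 : ∑ T ∈ ((insert x VB).powerset.filter (fun T => x ∈ T)).filter (fun T => a₂ ∉ T), ∑ S ∈ VA.powerset, RootEdge.SFg p ends o a₁ a₂ x γ (S ∪ T) =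
      ∑ T ∈ ((insert x VB).powerset.filter (fun T => x ∈ T)).filter (fun T => a₂ ∉ T), muT p ends EB x T * (γ * (∑ S ∈ VA.powerset.filter (fun S => a₁ ∈ S), alphaS p ends EA x S) + (∑ S ∈ VA.powerset.filter (fun S => a₁ ∉ S), alphaO p ends EA x a₁ o S)) :=
    Finset.sum_congr rfl fun T hT => by
      obtain ⟨⟨hT', hxT⟩, h2⟩ := mem_TT0 hT
      exact sum_S_SFg_of_notMem h ha1 ho ha2 hT' hxT h2 γ
  rw [sum_cross_pairs h a₁ a₂ _ (fun W hW => by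
      obtain ⟨hm, hs, hu⟩ := masses_eq_zero_of_fibre_eq_empty' (p := p) hW o
      unfold RootEdge.SFg; rw [hm, hs, hu]; ring),
    sum_T_split (a₂ := a₂), e2, e0, ← Finset.sum_mul, ← Finset.sum_mul]

/-- `∑_W Sb SFg(γ) / m_W = −Bβ₂ (2 Aρ₀ − γ A₀) + γ (Bb₀ − Bβ₀) A₁ − Bβ₀ Aρ₀`. -/
lemma sum_term_cross (hp : IsProbVec p) (h : IsCut ends x ↑VA ↑VB EA EB) (ha1 : a₁ ∈ VA)
    (ho : o ∈ VA) (ha2 : a₂ ∈ insert x VB) (hb : b ∈ insert x VB) (γ : R) :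
    ∑ W : Finset V, Ssig p ends a₁ a₂ x b W * RootEdge.SFg p ends o a₁ a₂ x γ W /
        mW p ends a₁ a₂ x W =
      -((∑ T ∈ ((insert x VB).powerset.filter (fun T => x ∈ T)).filter (fun T => a₂ ∈ T),
          muB p ends EB x a₂ b T) *
        (2 * ∑ S ∈ VA.powerset.filter (fun S => a₁ ∉ S), alphaO p ends EA x a₁ o S -
          γ * ∑ S ∈ VA.powerset.filter (fun S => a₁ ∉ S), alphaS p ends EA x S)) +
      (γ * ((∑ T ∈ ((insert x VB).powerset.filter (fun T => x ∈ T)).filter (fun T => a₂ ∉ T),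
            (if b ∈ T then muT p ends EB x T else 0)) -
          ∑ T ∈ ((insert x VB).powerset.filter (fun T => x ∈ T)).filter (fun T => a₂ ∉ T),
            muB p ends EB x a₂ b T) *
        (∑ S ∈ VA.powerset.filter (fun S => a₁ ∈ S), alphaS p ends EA x S) -
      (∑ T ∈ ((insert x VB).powerset.filter (fun T => x ∈ T)).filter (fun T => a₂ ∉ T),
          muB p ends EB x a₂ b T) *
        (∑ S ∈ VA.powerset.filter (fun S => a₁ ∉ S), alphaO p ends EA x a₁ o S)) := by
  have e2 : ∑ T ∈ ((insert x VB).powerset.filter (fun T => x ∈ T)).filter (fun T => a₂ ∈ T), ∑ S ∈ VA.powerset,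
        Ssig p ends a₁ a₂ x b (S ∪ T) * RootEdge.SFg p ends o a₁ a₂ x γ (S ∪ T) /
          mW p ends a₁ a₂ x (S ∪ T) =
      ∑ T ∈ ((insert x VB).powerset.filter (fun T => x ∈ T)).filter (fun T => a₂ ∈ T), -(muB p ends EB x a₂ b T * (2 * (∑ S ∈ VA.powerset.filter (fun S => a₁ ∉ S), alphaO p ends EA x a₁ o S) - γ * (∑ S ∈ VA.powerset.filter (fun S => a₁ ∉ S), alphaS p ends EA x S))) :=
    Finset.sum_congr rfl fun T hT => by
      obtain ⟨⟨hT', hxT⟩, h2⟩ := mem_TT2 hT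
      exact sum_S_term_of_mem hp h ha1 ho ha2 hb hT' hxT h2 γ
  have e0 : ∑ T ∈ ((insert x VB).powerset.filter (fun T => x ∈ T)).filter (fun T => a₂ ∉ T), ∑ S ∈ VA.powerset,
        Ssig p ends a₁ a₂ x b (S ∪ T) * RootEdge.SFg p ends o a₁ a₂ x γ (S ∪ T) /
          mW p ends a₁ a₂ x (S ∪ T) =
      ∑ T ∈ ((insert x VB).powerset.filter (fun T => x ∈ T)).filter (fun T => a₂ ∉ T), (γ * ((if b ∈ T then muT p ends EB x T else 0) - muB p ends EB x a₂ b T) *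
          (∑ S ∈ VA.powerset.filter (fun S => a₁ ∈ S), alphaS p ends EA x S) - muB p ends EB x a₂ b T * (∑ S ∈ VA.powerset.filter (fun S => a₁ ∉ S), alphaO p ends EA x a₁ o S)) :=
    Finset.sum_congr rfl fun T hT => by
      obtain ⟨⟨hT', hxT⟩, h2⟩ := mem_TT0 hT
      exact sum_S_term_of_notMem hp h ha1 ho ha2 hb hT' hxT h2 γ
  rw [sum_cross_pairs h a₁ a₂ _ (fun W hW => by
      rw [(masses_eq_zero_of_fibre_eq_empty' (p := p) hW b).2.1, zero_mul, zero_div]),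
    sum_T_split (a₂ := a₂), e2, e0, Finset.sum_neg_distrib, ← Finset.sum_mul, Finset.sum_sub_distrib,
    ← Finset.sum_mul, ← Finset.sum_mul, ← Finset.mul_sum, Finset.sum_sub_distrib]

/-! ## The `A`-sums -/

omit [Fintype V] [Fintype E] [DecidableEq E] [Field R] [LinearOrder R] [IsStrictOrderedRing R]
  [DecidablePred (· ∈ EA)] [DecidablePred (· ∈ EB)] in
/-- `a₁ ∉ S ∪ T ∧ a₂ ∉ S ∪ T` is `a₁ ∉ S` when `a₂ ∉ T`. -/
lemma notMem_union_iff (h : IsCut ends x ↑VA ↑VB EA EB) (ha1 : a₁ ∈ VA) (ha2 : a₂ ∈ insert x VB)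
    {S : Finset V} (hS : S ⊆ VA) {T : Finset V} (hT : T ⊆ insert x VB) (h2 : a₂ ∉ T) :
    (a₁ ∉ S ∪ T ∧ a₂ ∉ S ∪ T) ↔ a₁ ∉ S := by
  have h1T : a₁ ∉ T := fun hc => notMem_VA_of_mem_VB h (hT hc) ha1
  have h2S : a₂ ∉ S := fun hc => notMem_VA_of_mem_VB h ha2 (hS hc)
  simp only [Finset.mem_union, not_or]
  tauto

omit [Fintype E] [DecidableEq E] [LinearOrder R] [IsStrictOrderedRing R] [DecidablePred (· ∈ EA)]
  [DecidablePred (· ∈ EB)] in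
/-- **Every `A`-sum is a double sum over the class-III pairs** (`a₁ ∉ S`, `a₂ ∉ T`). -/
lemma sum_fibresA_cross (h : IsCut ends x ↑VA ↑VB EA EB) (ha1 : a₁ ∈ VA) (ha2 : a₂ ∈ insert x VB)
    (f : Finset V → R) (hf : ∀ W, fibre ends a₁ a₂ x W = ∅ → f W = 0) :
    ∑ W ∈ fibresA a₁ a₂, f W =
      ∑ T ∈ ((insert x VB).powerset.filter (fun T => x ∈ T)).filter (fun T => a₂ ∉ T),
        ∑ S ∈ VA.powerset.filter (fun S => a₁ ∉ S), f (S ∪ T) := by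
  rw [fibresA, Finset.sum_filter,
    sum_cross_pairs h a₁ a₂ _ (fun W hW => by rw [hf W hW]; simp)]
  rw [← Finset.sum_filter_of_ne (s := (insert x VB).powerset.filter (fun T => x ∈ T))
    (p := fun T => a₂ ∉ T)
    (f := fun T => ∑ S ∈ VA.powerset, if a₁ ∉ S ∪ T ∧ a₂ ∉ S ∪ T then f (S ∪ T) else 0) ?_]
  · refine Finset.sum_congr rfl fun T hT => ?_
    obtain ⟨⟨hT, hxT⟩, h2⟩ := mem_TT0 hT
    rw [Finset.sum_filter]
    refine Finset.sum_congr rfl fun S hS => ?_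
    rw [Finset.mem_powerset] at hS
    by_cases h1 : a₁ ∉ S
    · rw [if_pos h1, if_pos ((notMem_union_iff h ha1 ha2 hS hT h2).2 h1)]
    · rw [if_neg h1, if_neg (fun hc => h1 ((notMem_union_iff h ha1 ha2 hS hT h2).1 hc))]
  · intro T _ hne h2
    apply hne
    refine Finset.sum_eq_zero fun S _ => ?_
    rw [if_neg]
    intro hc
    exact hc.2 (Finset.mem_union_right S h2)

omit [Fintype V] [DecidableEq V] [Fintype E] [DecidableEq E] [Field R] [LinearOrder R]
  [IsStrictOrderedRing R] [DecidablePred (· ∈ EA)] [DecidablePred (· ∈ EB)] in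
/-- The class-III pairs are allowed. -/
lemma ok_of_class3 {S T : Finset V} (h1 : a₁ ∉ S) : ¬ (a₁ ∈ S ∧ a₂ ∈ T) := fun hc => h1 hc.1

/-- `∑_{W ∈ A} Su_b Su_o / m_W = Bβ₀ Aρ₀`. -/
lemma sum_termA_cross (hp : IsProbVec p) (h : IsCut ends x ↑VA ↑VB EA EB) (ha1 : a₁ ∈ VA)
    (ho : o ∈ VA) (ha2 : a₂ ∈ insert x VB) (hb : b ∈ insert x VB) :
    ∑ W ∈ fibresA a₁ a₂, Su p ends a₁ a₂ x b W * Su p ends a₁ a₂ x o W / mW p ends a₁ a₂ x W =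
      (∑ T ∈ ((insert x VB).powerset.filter (fun T => x ∈ T)).filter (fun T => a₂ ∉ T),
          muB p ends EB x a₂ b T) *
        (∑ S ∈ VA.powerset.filter (fun S => a₁ ∉ S), alphaO p ends EA x a₁ o S) := by
  rw [sum_fibresA_cross h ha1 ha2 _ (fun W hW => by
      rw [(masses_eq_zero_of_fibre_eq_empty' (p := p) hW b).2.2, zero_mul, zero_div]),
    Finset.sum_mul_sum]
  refine Finset.sum_congr rfl fun T hT => Finset.sum_congr rfl fun S hS => ?_
  obtain ⟨⟨hT, hxT⟩, h2⟩ := mem_TT0 hT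
  rw [Finset.mem_filter, Finset.mem_powerset] at hS
  have hok := ok_of_class3 (a₂ := a₂) (T := T) hS.2
  rw [Su_b_cross h ha1 ha2 hb hS.1 hT hxT hok, Su_o_cross h ha1 ho ha2 hS.1 hT hxT hok,
    mW_cross h ha1 ha2 hS.1 hT hxT hok, if_neg (show ¬ (a₁ ∈ S ∧ b ∈ T) from fun hc => hS.2 hc.1),
    if_neg (show ¬ (o ∈ S ∧ a₂ ∈ T) from fun hc => h2 hc.2)]
  by_cases hα : alphaS p ends EA x S = 0
  · rw [hα, alphaO_eq_zero hp hα]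
    simp
  by_cases hμ : muT p ends EB x T = 0
  · rw [hμ, muB_eq_zero hp hμ]
    simp
  · rw [div_eq_iff (mul_ne_zero hα hμ)]
    ring

omit [LinearOrder R] [IsStrictOrderedRing R] in
/-- `∑_{W ∈ A} Su_b W = Bβ₀ A₀`. -/
lemma sum_SuA_b_cross (h : IsCut ends x ↑VA ↑VB EA EB) (ha1 : a₁ ∈ VA) (ha2 : a₂ ∈ insert x VB)
    (hb : b ∈ insert x VB) :
    ∑ W ∈ fibresA a₁ a₂, Su p ends a₁ a₂ x b W =
      (∑ T ∈ ((insert x VB).powerset.filter (fun T => x ∈ T)).filter (fun T => a₂ ∉ T),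
          muB p ends EB x a₂ b T) *
        (∑ S ∈ VA.powerset.filter (fun S => a₁ ∉ S), alphaS p ends EA x S) := by
  rw [sum_fibresA_cross h ha1 ha2 _ (fun W hW => (masses_eq_zero_of_fibre_eq_empty' (p := p) hW b).2.2),
    Finset.sum_mul_sum]
  refine Finset.sum_congr rfl fun T hT => Finset.sum_congr rfl fun S hS => ?_
  obtain ⟨⟨hT, hxT⟩, _⟩ := mem_TT0 hT
  rw [Finset.mem_filter, Finset.mem_powerset] at hS
  rw [Su_b_cross h ha1 ha2 hb hS.1 hT hxT (ok_of_class3 hS.2),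
    if_neg (show ¬ (a₁ ∈ S ∧ b ∈ T) from fun hc => hS.2 hc.1)]
  ring

omit [LinearOrder R] [IsStrictOrderedRing R] in
/-- `∑_{W ∈ A} Su_o W = B₀ Aρ₀`. -/
lemma sum_SuA_o_cross (h : IsCut ends x ↑VA ↑VB EA EB) (ha1 : a₁ ∈ VA) (ho : o ∈ VA)
    (ha2 : a₂ ∈ insert x VB) :
    ∑ W ∈ fibresA a₁ a₂, Su p ends a₁ a₂ x o W =
      (∑ T ∈ ((insert x VB).powerset.filter (fun T => x ∈ T)).filter (fun T => a₂ ∉ T),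
          muT p ends EB x T) *
        (∑ S ∈ VA.powerset.filter (fun S => a₁ ∉ S), alphaO p ends EA x a₁ o S) := by
  rw [sum_fibresA_cross h ha1 ha2 _ (fun W hW => (masses_eq_zero_of_fibre_eq_empty' (p := p) hW o).2.2),
    Finset.sum_mul_sum]
  refine Finset.sum_congr rfl fun T hT => Finset.sum_congr rfl fun S hS => ?_
  obtain ⟨⟨hT, hxT⟩, h2⟩ := mem_TT0 hT
  rw [Finset.mem_filter, Finset.mem_powerset] at hS
  rw [Su_o_cross h ha1 ho ha2 hS.1 hT hxT (ok_of_class3 hS.2),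
    if_neg (show ¬ (o ∈ S ∧ a₂ ∈ T) from fun hc => h2 hc.2)]
  ring

omit [LinearOrder R] [IsStrictOrderedRing R] in
/-- `P(PD) = B₀ A₀`. -/
lemma prob_PD_cross (h : IsCut ends x ↑VA ↑VB EA EB) (ha1 : a₁ ∈ VA) (ha2 : a₂ ∈ insert x VB) :
    prob p (PDEvent ends a₁ a₂ x) =
      (∑ T ∈ ((insert x VB).powerset.filter (fun T => x ∈ T)).filter (fun T => a₂ ∉ T),
          muT p ends EB x T) *
        (∑ S ∈ VA.powerset.filter (fun S => a₁ ∉ S), alphaS p ends EA x S) := by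
  rw [prob_PD_eq_fibresA,
    sum_fibresA_cross h ha1 ha2 _ (fun W hW => (masses_eq_zero_of_fibre_eq_empty' (p := p) hW x).1),
    Finset.sum_mul_sum]
  refine Finset.sum_congr rfl fun T hT => Finset.sum_congr rfl fun S hS => ?_
  obtain ⟨⟨hT, hxT⟩, _⟩ := mem_TT0 hT
  rw [Finset.mem_filter, Finset.mem_powerset] at hS
  rw [mW_cross h ha1 ha2 hS.1 hT hxT (ok_of_class3 hS.2), mul_comm]

/-! ## The identity -/

omit [Fintype V] [DecidableEq V] [Fintype E] [DecidableEq E] [LinearOrder R] [IsStrictOrderedRing R]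
  [DecidablePred (· ∈ EA)] [DecidablePred (· ∈ EB)] in
/-- The abstract cancellation: if the ratio sum is `γ ∑ Sb`, the `F`-sum is `γ P(Q)` and the
`A`-terms agree, `btw = 0`. -/
lemma assembly_aux (γ T1 T2 T3 PQ T4 T5 T6 D : R) (hQ : PQ ≠ 0) (hD : D ≠ 0) (h1 : T1 = γ * T2)
    (h3 : T3 = γ * PQ) (h4 : T4 * D = T5 * T6) : T1 - T2 * T3 / PQ - T4 + T5 * T6 / D = 0 := by
  rw [h1, h3, ← h4]
  field_simp
  ring

/-- **The cross-shield identity**: `btw(x) = 0` when the explored cut vertex `x` separates `{a₁, o}`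
from `{a₂, b}` and `P(PD_x) ≠ 0`. -/
theorem btw_cross (hp : IsProbVec p) (h : IsCut ends x ↑VA ↑VB EA EB) (ha1 : a₁ ∈ VA) (ho : o ∈ VA)
    (ha2 : a₂ ∈ insert x VB) (hb : b ∈ insert x VB) (hD : prob p (PDEvent ends a₁ a₂ x) ≠ 0) :
    btw p ends o a₁ a₂ x b = 0 := by
  have hQ : prob p (avoidAll ends a₂ {a₁}) ≠ 0 := by
    intro h0
    apply hD
    have key := prob_PD_le_Q hp ends a₁ a₂ x
    rw [h0] at key
    exact le_antisymm key (prob_nonneg hp _)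
  have hγ : gamma p ends o a₁ a₂ x *
      (∑ S ∈ VA.powerset.filter (fun S => a₁ ∉ S), alphaS p ends EA x S) =
      ∑ S ∈ VA.powerset.filter (fun S => a₁ ∉ S), alphaO p ends EA x a₁ o S := by
    unfold gamma
    rw [Do_eq_fibresA, sum_SuA_o_cross h ha1 ho ha2, prob_PD_cross h ha1 ha2]
    rw [prob_PD_cross h ha1 ha2] at hD
    have hB := left_ne_zero_of_mul hD
    have hA := right_ne_zero_of_mul hD
    field_simp
  rw [← RootEdge.btwg_gamma]
  unfold RootEdge.btwg
  rw [sum_term_cross hp h ha1 ho ha2 hb, sum_Ssig_b_cross h ha1 ha2 hb, sum_SFg_cross h ha1 ho ha2,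
    sum_termA_cross hp h ha1 ho ha2 hb, sum_SuA_b_cross h ha1 ha2 hb, sum_SuA_o_cross h ha1 ho ha2,
    ← sum_mW p ends a₁ a₂ x, sum_mW_cross h ha1 ha2, prob_PD_cross h ha1 ha2]
  rw [← sum_mW p ends a₁ a₂ x, sum_mW_cross h ha1 ha2] at hQ
  rw [prob_PD_cross h ha1 ha2] at hD
  refine assembly_aux (gamma p ends o a₁ a₂ x) _ _ _ _ _ _ _ _ hQ hD ?_ ?_ ?_
  · rw [← hγ]
    ring
  · rw [← hγ]
    ring
  · ring

/-- **(MEANS-a₃) at `x` with `{a₁, o}` behind it**, unconditionally (at `P(PD_x) = 0` by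
`RootEdge.A3Between_of_PD_null`). -/
theorem A3Between_cross (hp : IsProbVec p) (h : IsCut ends x ↑VA ↑VB EA EB) (ha1 : a₁ ∈ VA)
    (ho : o ∈ VA) (ha2 : a₂ ∈ insert x VB) (hb : b ∈ insert x VB) :
    A3Between p ends o a₁ a₂ x b := by
  by_cases hD : prob p (PDEvent ends a₁ a₂ x) = 0
  · exact RootEdge.A3Between_of_PD_null p hp o b hD
  · unfold A3Between
    rw [btw_cross hp h ha1 ho ha2 hb hD]

/-- **(HCOV) at `x` with `{a₁, o}` behind it.** -/
theorem HCov_cross (hp : IsProbVec p) (h : IsCut ends x ↑VA ↑VB EA EB) (ha1 : a₁ ∈ VA) (ho : o ∈ VA)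
    (ha2 : a₂ ∈ insert x VB) (hb : b ∈ insert x VB) : HCov p ends o a₁ a₂ x b :=
  HCov_of_a3Between hp ends o a₁ a₂ x b (A3Between_cross hp h ha1 ho ha2 hb)

end Assembly

end CrossShield

end A3Fibre

end CovForm

end Summit.Ventures.PercRepro2
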